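/-
Copyright (c) 2026 the pub-hodgecm-mathlib formalisation cell (harness21).  Prover seat hodgecm-mathlib-F0P3a-p04 (g22): line LH3 (closer stub `stub_N9`), micro-brick
(J-KIT-U) for the (J-HEAD) assembler (LH3-plan (g3) 07:46:17Z (i)); 2026-09-02.
-/
import Literature.NumberTheory.Automorphic.Shelstad1979.StableOrbitalIntegrals   -- ★ the predicate `HasOneSidedJump F J` (both one-sided limits at `0` exist, difference `J`)
import HarnessLib

/-!
# One-sided jumps are UNIQUE, and the division form used to book jump constants ([Shelstad1979] §4 p. 22)

Topic `NumberTheory/Automorphic/Shelstad1979`; namespace `Literature.NumberTheory.Automorphic.Shelstad1979.StableOrbitalIntegrals` (the namespace of the ★ predicate, so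
that dot notation `h.unique`, `h.eq_of_mul_ne_zero` works for every consumer).  THEOREMS ONLY (no definition, no instance, no notation, no `sorry`).  Cell `pub/hodgecm-mathlib`
(D-0151), crux H413 = `stmt-HodgeConjecture-24833`, line LH3 (closer row `stub_N9`, leaf `F0_P3c_StubN9Direct`, organ J «jump agreement»): LH3-plan (g3) RULINGS #4 (c) ∕
07:46:17Z (i) — the (J-HEAD) assembler `agreesOnAdmissibleCoveredSlots_of_bricks` (LH4-p03 (g4)) computes, per covered wall, ONE jump two ways (explicitly: `= c · value`;
from the membership: `= jc · value`) and DIVIDES; this file is that division, once and for all.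

★ `HasOneSidedJump F J := ∃ Lp Lm, Tendsto F (𝓝[>] 0) (𝓝 Lp) ∧ Tendsto F (𝓝[<] 0) (𝓝 Lm) ∧ Lp − Lm = J` (`Shelstad1979/StableOrbitalIntegrals`).  Since `𝓝[>] 0` and
`𝓝[<] 0` on `ℝ` are non-trivial filters and `ℂ` is Hausdorff, `Lp`, `Lm` — hence `J` — are determined by `F` (Mathlib `tendsto_nhds_unique`).  Not restated here (already ★):
`HasOneSidedJump.const_mul` ∕ `.congr_nhdsWithin` ∕ `.jump_congr` (`Rogawski1990/ArchBouazizStableFamilyJumpZero`), `.congr` ∕ `.reflect_sub` (`ArchRankOneJumpZeroStable`),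
`hasOneSidedJump_add ∕ _sum ∕ _neg ∕ _mul_of_tendsto ∕ _zero_of_tendsto ∕ _comp_neg ∕ _congr_eventuallyEq` (`Rogawski1990/ArchTransfFamilyJumpKit`).

* `HasOneSidedJump.unique` — `HasOneSidedJump F J → HasOneSidedJump F J′ → J = J′`.
* `HasOneSidedJump.eq_of_mul_ne_zero` — `HasOneSidedJump F (a * v) → HasOneSidedJump F (b * v) → v ≠ 0 → a = b` (and the left-factor twin `…_left`).
* `HasOneSidedJump.eq_div_of_ne_zero` — `HasOneSidedJump F (a * v) → HasOneSidedJump F J → v ≠ 0 → a = J / v`.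
* `HasOneSidedJump.eq_zero_of_tendsto` — a function with a two-sided limit at `0` has jump `0` (so any booked jump of it vanishes).

HONEST LABEL: count-neutral kit; HC_CM is proved only modulo the 7 printed citations (2 remaining: hLiu418 = stmt-HodgeConjecture-24832, h413 = stmt-HodgeConjecture-24833)
until rung 0 closes.

## References
* [Shelstad1979] D. Shelstad, *Characters and inner forms of a quasi-split group over `ℝ`*, Compositio Math. 39 (1979), §4 p. 22 («`lim_{ν↓0}` and `lim_{ν↑0}` are
  well-defined»), Lemma 4.3 p. 25.
* [Rogawski1990] J. D. Rogawski, *Automorphic Representations of Unitary Groups in Three Variables*, Ann. of Math. Stud. 123 (1990), §8.2 p. 122 (jump relations at the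
  archimedean places).
-/

set_option autoImplicit false

noncomputable section

open Filter Topology

namespace Literature.NumberTheory.Automorphic.Shelstad1979.StableOrbitalIntegrals

/-- **One-sided jumps are unique**: the one-sided limits of `F` at `0` (filters `𝓝[>] 0`, `𝓝[<] 0`, both non-trivial on `ℝ`) are unique in the Hausdorff space `ℂ`, hence so
is their difference. [cite: Shelstad1979, §4 p. 22] -/
theorem HasOneSidedJump.unique {F : ℝ → ℂ} {J J' : ℂ} (h : HasOneSidedJump F J) (h' : HasOneSidedJump F J') : J = J' := by
  obtain ⟨Lp, Lm, hp, hm, hJ⟩ := h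
  obtain ⟨Lp', Lm', hp', hm', hJ'⟩ := h'
  rw [← hJ, ← hJ', tendsto_nhds_unique hp hp', tendsto_nhds_unique hm hm']

/-- **Division form (right factor)**: if the same `F` jumps by `a · v` and by `b · v` with `v ≠ 0`, then `a = b` — the booking step «`c · value = jc · value`, `value ≠ 0`
⇒ `c = jc`» of the jump-agreement argument. [cite: Shelstad1979, §4 p. 22] [cite: Rogawski1990, §8.2 p. 122] -/
theorem HasOneSidedJump.eq_of_mul_ne_zero {F : ℝ → ℂ} {a b v : ℂ} (h : HasOneSidedJump F (a * v)) (h' : HasOneSidedJump F (b * v)) (hv : v ≠ 0) :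
    a = b :=
  mul_right_cancel₀ hv (h.unique h')

/-- **Division form (left factor)**: `HasOneSidedJump F (v * a) → HasOneSidedJump F (v * b) → v ≠ 0 → a = b`. [cite: Shelstad1979, §4 p. 22] -/
theorem HasOneSidedJump.eq_of_mul_ne_zero_left {F : ℝ → ℂ} {a b v : ℂ} (h : HasOneSidedJump F (v * a)) (h' : HasOneSidedJump F (v * b)) (hv : v ≠ 0) :
    a = b :=
  mul_left_cancel₀ hv (h.unique h')

/-- **The constant as a quotient**: `HasOneSidedJump F (a * v) → HasOneSidedJump F J → v ≠ 0 → a = J / v`. [cite: Shelstad1979, §4 p. 22] -/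
theorem HasOneSidedJump.eq_div_of_ne_zero {F : ℝ → ℂ} {a v J : ℂ} (h : HasOneSidedJump F (a * v)) (h' : HasOneSidedJump F J) (hv : v ≠ 0) :
    a = J / v := by
  rw [eq_div_iff hv]
  exact h.unique h'

/-- **Three factors**: `HasOneSidedJump F (a * u * v) → HasOneSidedJump F (b * u * v) → u ≠ 0 → v ≠ 0 → a = b` (the shape `jc · 1 · value` of the order-`0` reading).
[cite: Shelstad1979, §4 p. 22] -/
theorem HasOneSidedJump.eq_of_mul_mul_ne_zero {F : ℝ → ℂ} {a b u v : ℂ} (h : HasOneSidedJump F (a * u * v)) (h' : HasOneSidedJump F (b * u * v))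
    (hu : u ≠ 0) (hv : v ≠ 0) : a = b :=
  mul_right_cancel₀ hu (mul_right_cancel₀ hv (h.unique h'))

/-- **A function continuous at `0` (two-sided limit) has jump `0`**: both one-sided limits are the two-sided one. [cite: Shelstad1979, §4 p. 22] -/
theorem HasOneSidedJump.eq_zero_of_tendsto {F : ℝ → ℂ} {J l : ℂ} (h : HasOneSidedJump F J) (hl : Tendsto F (𝓝 (0 : ℝ)) (𝓝 l)) : J = 0 :=
  h.unique ⟨l, l, hl.mono_left nhdsWithin_le_nhds, hl.mono_left nhdsWithin_le_nhds, sub_self l⟩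

/-- **Booked jump of a non-jumping function**: if `F` is continuous at `0` and jumps by `a * v` with `v ≠ 0`, then `a = 0`. [cite: Shelstad1979, §4 p. 22] -/
theorem HasOneSidedJump.eq_zero_of_tendsto_of_mul {F : ℝ → ℂ} {a v l : ℂ} (h : HasOneSidedJump F (a * v)) (hl : Tendsto F (𝓝 (0 : ℝ)) (𝓝 l)) (hv : v ≠ 0) :
    a = 0 := by
  have h0 : a * v = 0 := h.eq_zero_of_tendsto hl
  rcases mul_eq_zero.1 h0 with ha | hv0
  · exact ha
  · exact absurd hv0 hv

end Literature.NumberTheory.Automorphic.Shelstad1979.StableOrbitalIntegrals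

end
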